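import Summits.QuantumFields.YangMills.Theorems.BalabanUVNodesN18BetaOfRecordBoxDegeneracy
import HarnessLib

/-!
# BalabanUVNodes ∕ node N18 = NE5 — № 13's MISSING LETTER IN THE TREE's OWN ONE-LOOP SPLIT (β¹-FORM): under the located side condition «the base history runs inside
# the box», `betaOfRecord₁₃` is boxwise constant ONLY IF it coincides on every box with its own one-loop number `beta0OfMerged … θ.v₀` (the split's remainder `β¹ ≡ 0`
# there); a non-vanishing remainder at ONE box point is the letter

Cell `pub-ymgap`, width seat `pub-ymgap-dag-n18-w2` (g2); SECOND FILE of the № 13 answer (plan g81, pub-ymgap INBOX l.26426; first file p596517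
`Thm/BalabanUVNodesN18BetaOfRecordBoxDegeneracy` — the decision NO ∕ NOT FORCED, the independence certificate, the missing letter `RemainderNonvanishingOnBoxes` in K2⁷'s ANCHOR
currency).  This file writes the same letter in NODE 00's SPLIT currency (`Node00.oneLoopSplit_betaOfMerged`, `beta0OfMerged βm v₀ k := limUnder (𝓝[>] 0) (g ↦ βm k (update (v₀ k) last g))`,
`Node00/BetaOfRecord`), following dag-n18-w1 g2's addendum (pub-ymgap INBOX l.26613 (2)).  `--supports stmt-QuantumFields-20544` (K3⁷) AS A HELPER — count-neutral; definition lane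
by content (ONE hypothesis shape `BaseInBox`, asserted for nothing) + kernel theorems.

WHAT IS PROVED.
* `BaseInBox γ v₀ k` (shape) — the base history's first `k` entries lie in `]0, γ]`, so that the reference path `g ↦ update (v₀ k) last g` runs INSIDE the box `]0,γ]^{k+1}` for
  `g ∈ ]0, γ]` (`update_mem_box_of_baseInBox`).  LOCATED: NO admissibility clause of the Stage-8…13 records places `θ.v₀` there (`Node00/Record8` :51 declares `v₀` free; `Record9`
  :116, `Record12` :274, `Record13` :133 add numeric signs and the chart pin only) — a second small letter for a (w18) edition IF the β¹-form is the displayed one.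
* ★ `beta0OfMerged_eq_of_const_on_box` — a merged β CONSTANT `≡ c` on the box `]0,γ]^{k+1}` (`0 < γ`, base inside the box) has `beta0OfMerged βm v₀ k = c`: the `limUnder` of a
  germ eventually equal to `c` along `𝓝[>] 0` (`Ioc_mem_nhdsGT`, `Tendsto.limUnder_eq`) — NO existence letter (`Beta0LimitExists`) needed in this direction.
* ★ `beta1_eq_zero_on_box_of_boxwiseConstant` — if `betaOfMerged βm (beta0OfMerged βm v₀) γ` (the shape of EVERY β of record since Stage 8) is boxwise constant, the printed
  split's remainder `(oneLoopSplit_betaOfMerged …).β1 k` VANISHES on the whole box; ★ `not_boxwiseConstant_of_beta1_ne_zero` — contrapositive: `β¹ k v ≠ 0` at ONE box point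
  ⇒ NOT boxwise constant.  THE MISSING LETTER IN β¹-FORM: «the (2.13) remainder's contribution to (1.22) does not vanish identically on the window» — [Balaban1987RG1] gives
  its UPPER side only ((2.13) «vanishes at g_k = 0» p. 268; p. 264 L25–27 «smooth … uniformly bounded on this interval together with all derivatives. We will investigate other
  properties in a separate paper»).
* At the Stage-13 record: `betaOfRecord₁₃_eq_beta0_on_box_of_boxwiseConstant` (boxwise constant + `BaseInBox θ.γ θ.v₀ k` ⇒ ON the box `β₁₃ k` IS its own one-loop number) and
  ★ `not_boxwiseConstant_betaOfRecord₁₃_of_ne_beta0` (β₁₃ differs from its one-loop number at one box point ⇒ `¬ BoxwiseConstant θ.γ (betaOfRecord₁₃ F N θ)`, whence the K3⁷ v3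
  guard under the pin by p596517 §3b ∕ p592505).
RELATION TO FILE 1.  Under an ANCHOR at `b` (K2⁷'s `ScaleAnchor`; file 1 §2) the letter reads `β k v ≠ b k`; here, under `BaseInBox`, it reads `β k v ≠ beta0OfMerged βm v₀ k` — the
two reference sequences coincide whenever both side conditions hold and β is boxwise constant (both equal the box value: `anchor_eq_beta0OfMerged_of_boxwiseConstant`); neither
file asserts either side condition at the record.

A6 (№189).  `BaseInBox γ v₀ k` is inhabited by any constant history `fun _ ↦ γ` with `0 < γ`; the binders of `not_boxwiseConstant_of_beta1_ne_zero` are jointly inhabited by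
`βm k v := v (Fin.last k)` with that base (then `β⁰ k = 0`, `β¹ k v = v_last ≠ 0` on the box) — `exists_baseInBox_and_beta1_ne_zero`, a test object; the record-level hypotheses are LOCATED (displayed,
inhabited by nothing here).

HONEST FRAMING.  Count-neutral helper: one shape + kernel bookkeeping; NOTHING of Bałaban's is asserted; `¬ BoxwiseConstant θ.γ β₁₃` NEITHER proved NOR refuted at the record;
N18 NOT discharged; K3⁷ OPEN, not claimed; no count claim; counts UNMOVED (typed 28∕28 · discharged 5∕27 (A 5∕28)).  One finite four-torus programme at fixed `ε`, Bałaban as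
printed; R4 closes the conditional finite-𝕋⁴ rung `BalabanLadder.UV` only — NOT ℝ⁴, NOT infinite volume, NOT OS, NOT a mass gap, NOT Clay.  No `sorry`, no `instance`, no
`notation`, no `structure`.
-/

set_option autoImplicit false

noncomputable section

namespace YMDAG.N18.BetaBoxDegeneracy

open scoped Matrix.Norms.L2Operator
open Literature.MathematicalPhysics.QuantumFieldTheory.Balaban1983to89
open Literature.MathematicalPhysics.QuantumFieldTheory.Balaban1983to89.T4Continuum (T4Family)
open Literature.MathematicalPhysics.QuantumFieldTheory.Balaban1983to89.FlowStep (Box HBeta mem_box)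
open Literature.MathematicalPhysics.QuantumFieldTheory.Balaban1983to89.Node00 (Stage13Params betaOfRecord₁₃ betaMerged betaOfMerged betaOfMerged_of_mem mergedTermFamilyMatT
  TβOfRecord₁₃ chiβOfRecord₁₃)
open YMDAG.N18.U3Guards (BoxwiseConstant)

/-! ## §1 The β¹-form of the missing letter, generic shape `betaOfMerged βm (beta0OfMerged βm v₀) γ` -/

section SplitForm

open Filter Topology
open Literature.MathematicalPhysics.QuantumFieldTheory.Balaban1983to89.Node00 (beta0OfMerged oneLoopSplit_betaOfMerged)

variable {βm : HBeta} {v₀ : (k : ℕ) → (Fin (k + 1) → ℝ)} {γ : ℝ} {k : ℕ}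

/-- **THE BASE HISTORY RUNS INSIDE THE BOX** (located side condition, shape): the first `k` entries of the base history `v₀ k` (at which the one-loop number
`beta0OfMerged βm v₀ k` reads the `g_k → 0⁺` limit) lie in `]0, γ]` — so that `update (v₀ k) last g ∈ ]0,γ]^{k+1}` for small `g > 0`.  NO admissibility clause of the
Stage-8…13 records places `θ.v₀` there (`Node00/Record8` :51; a second located letter for a (w18) edition if the β¹-form is displayed).  Asserted for nothing. [folklore] -/
@[folklore]
def BaseInBox (γ : ℝ) (v₀ : (k : ℕ) → (Fin (k + 1) → ℝ)) (k : ℕ) : Prop :=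
  ∀ i : Fin (k + 1), i ≠ Fin.last k → 0 < v₀ k i ∧ v₀ k i ≤ γ

/-- Under `BaseInBox`, the reference path `g ↦ update (v₀ k) last g` lies in the box for `g ∈ ]0, γ]`. [folklore] -/
theorem update_mem_box_of_baseInBox (h : BaseInBox γ v₀ k) {g : ℝ} (hg : g ∈ Set.Ioc (0 : ℝ) γ) :
    Function.update (v₀ k) (Fin.last k) g ∈ Box γ k := by
  refine mem_box.mpr fun i => ?_
  by_cases hi : i = Fin.last k
  · subst hi
    simpa using hg
  · simpa [Function.update_of_ne hi] using h i hi

/-- **A MERGED β CONSTANT ON A BOX HAS THAT CONSTANT AS ITS ONE-LOOP NUMBER** (no existence letter needed): if `βm k ≡ c` on `]0,γ]^{k+1}` (`0 < γ`) and the base history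
runs inside the box, then `beta0OfMerged βm v₀ k = c` — the `limUnder (𝓝[>] 0)` of a germ that is eventually the constant `c`. [folklore] -/
theorem beta0OfMerged_eq_of_const_on_box {c : ℝ} (hγ : 0 < γ) (hv₀ : BaseInBox γ v₀ k) (hc : ∀ v : Fin (k + 1) → ℝ, v ∈ Box γ k → βm k v = c) :
    beta0OfMerged βm v₀ k = c := by
  unfold beta0OfMerged
  refine Filter.Tendsto.limUnder_eq ?_
  refine tendsto_const_nhds.congr' ?_
  filter_upwards [Ioc_mem_nhdsGT hγ] with g hg
  exact (hc _ (update_mem_box_of_baseInBox hv₀ hg)).symm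

/-- **★ β¹-FORM, DEGENERATE DIRECTION**: if the β of record's shape `betaOfMerged βm (beta0OfMerged βm v₀) γ` is BOXWISE CONSTANT (`0 < γ`, base history inside the box at
scale `k`), then the one-loop split's REMAINDER `β¹ k` (`oneLoopSplit_betaOfMerged`, `β¹ = 𝟙_box·(βm − β⁰)`) VANISHES on the whole box `]0,γ]^{k+1}`. [folklore] -/
theorem beta1_eq_zero_on_box_of_boxwiseConstant (hγ : 0 < γ) (hv₀ : BaseInBox γ v₀ k)
    (h : BoxwiseConstant γ (betaOfMerged βm (beta0OfMerged βm v₀) γ)) (v : Fin (k + 1) → ℝ) (hv : v ∈ Box γ k) :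
    (oneLoopSplit_betaOfMerged βm (beta0OfMerged βm v₀) γ).β1 k v = 0 := by
  have hconst : ∀ w : Fin (k + 1) → ℝ, w ∈ Box γ k → βm k w = βm k v := fun w hw => by
    have h' := h k w v hw hv
    rwa [betaOfMerged_of_mem _ _ _ hw, betaOfMerged_of_mem _ _ _ hv] at h'
  have h0 : beta0OfMerged βm v₀ k = βm k v := beta0OfMerged_eq_of_const_on_box hγ hv₀ hconst
  show (Box γ k).indicator (fun w => βm k w - beta0OfMerged βm v₀ k) v = 0
  rw [Set.indicator_of_mem hv, h0, sub_self]

/-- **★ β¹-FORM OF THE MISSING LETTER**: a NON-VANISHING one-loop REMAINDER `β¹ k v ≠ 0` at ONE box point (base history inside the box at that scale) forces «NOT boxwise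
constant» — print's (2.13)-remainder contribution to (1.22) read in the tree's own split; [Balaban1987RG1] gives its UPPER side only ((2.13) p. 268, p. 264). [folklore] -/
theorem not_boxwiseConstant_of_beta1_ne_zero (hγ : 0 < γ) (hv₀ : BaseInBox γ v₀ k) {v : Fin (k + 1) → ℝ} (hv : v ∈ Box γ k)
    (hne : (oneLoopSplit_betaOfMerged βm (beta0OfMerged βm v₀) γ).β1 k v ≠ 0) :
    ¬ BoxwiseConstant γ (betaOfMerged βm (beta0OfMerged βm v₀) γ) :=
  fun h => hne (beta1_eq_zero_on_box_of_boxwiseConstant hγ hv₀ h v hv)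

/-- **THE TWO CURRENCIES AGREE ON A DEGENERATE β**: if `betaOfMerged βm (beta0OfMerged βm v₀) γ` is boxwise constant, anchored at `b` (file 1's inline `ScaleAnchor` binder) and
its base history runs inside the box at scale `k` (`0 < γ`), then the anchor's number and the split's one-loop number coincide at `k`: `b k = beta0OfMerged βm v₀ k` (both are the
box value).  Neither side condition is asserted at any record. [folklore] -/
theorem anchor_eq_beta0OfMerged_of_boxwiseConstant {b : ℕ → ℝ} (hγ : 0 < γ) (hv₀ : BaseInBox γ v₀ k)
    (hA : ∀ (k : ℕ) (δ : ℝ), 0 < δ → ∃ γ' : ℝ, 0 < γ' ∧ ∀ p : Fin (k + 1) → ℝ, p ∈ B12Beta.HistBox γ' k →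
      |betaOfMerged βm (beta0OfMerged βm v₀) γ k p - b k| ≤ δ)
    (h : BoxwiseConstant γ (betaOfMerged βm (beta0OfMerged βm v₀) γ)) : b k = beta0OfMerged βm v₀ k := by
  have hγb : (fun _ : Fin (k + 1) => γ) ∈ Box γ k := mem_box.mpr fun _ => ⟨hγ, le_rfl⟩
  have h1 := (boxwiseConstant_iff_eq_anchor_on_boxes hA).mp h k _ hγb
  have h2 := beta1_eq_zero_on_box_of_boxwiseConstant hγ hv₀ h _ hγb
  change (Box γ k).indicator (fun w => βm k w - beta0OfMerged βm v₀ k) (fun _ : Fin (k + 1) => γ) = 0 at h2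
  rw [Set.indicator_of_mem hγb, sub_eq_zero] at h2
  rw [betaOfMerged_of_mem _ _ _ hγb] at h1
  rw [← h1, h2]

/-- **A6 (№189) — THE BINDERS OF `not_boxwiseConstant_of_beta1_ne_zero` ARE JOINTLY SATISFIABLE**: with the merged β `βm k v := v (Fin.last k)` (the last coupling itself) and
the constant base history `γ` (`0 < γ`): the base runs inside the box, the one-loop number is `limUnder (𝓝[>] 0) id = 0`, and the remainder `β¹ k v = v_last ≠ 0` at every box
point.  A test object, not a claim about any record. [folklore] -/
theorem exists_baseInBox_and_beta1_ne_zero (hγ : 0 < γ) (k : ℕ) :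
    ∃ (βm : HBeta) (v₀ : (k : ℕ) → (Fin (k + 1) → ℝ)), BaseInBox γ v₀ k ∧
      ∃ v : Fin (k + 1) → ℝ, v ∈ Box γ k ∧ (oneLoopSplit_betaOfMerged βm (beta0OfMerged βm v₀) γ).β1 k v ≠ 0 := by
  refine ⟨fun k v => v (Fin.last k), fun _ _ => γ, fun _ _ => ⟨hγ, le_rfl⟩, fun _ => γ, mem_box.mpr fun _ => ⟨hγ, le_rfl⟩, ?_⟩
  have h0 : beta0OfMerged (fun k v => v (Fin.last k)) (fun _ _ => γ) k = 0 := by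
    unfold beta0OfMerged
    refine Filter.Tendsto.limUnder_eq ?_
    exact ((tendsto_id : Tendsto (id : ℝ → ℝ) (𝓝 0) (𝓝 0)).mono_left nhdsWithin_le_nhds).congr fun g => by simp
  show (Box γ k).indicator (fun w : Fin (k + 1) → ℝ => w (Fin.last k) - beta0OfMerged (fun k v => v (Fin.last k)) (fun _ _ => γ) k) (fun _ => γ) ≠ 0
  rw [Set.indicator_of_mem (mem_box.mpr fun _ => ⟨hγ, le_rfl⟩), h0, sub_zero]
  exact hγ.ne'

end SplitForm

/-! ## §2 At the Stage-13 record -/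

section SplitFormRecord

variable {F : T4Family} {N : ℕ} [NeZero N] (θ : Stage13Params F N)

open Literature.MathematicalPhysics.QuantumFieldTheory.Balaban1983to89.Node00 (beta0OfMerged oneLoopSplit_betaOfMerged)

/-- **AT THE RECORD, DEGENERATE DIRECTION**: if `betaOfRecord₁₃ F N θ` is boxwise constant on the window (`0 < θ.γ`) and the base history `θ.v₀` runs inside the box at scale `k`,
then ON the box β₁₃ IS its own one-loop number: `β₁₃ k v = beta0OfMerged βm_rec θ.v₀ k` — the (2.13) remainder's (1.22) second moment vanishes identically at scale `k`. [folklore] -/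
theorem betaOfRecord₁₃_eq_beta0_on_box_of_boxwiseConstant (hγ : 0 < θ.γ) {k : ℕ} (hv₀ : BaseInBox θ.γ θ.v₀ k)
    (h : BoxwiseConstant θ.γ (betaOfRecord₁₃ F N θ)) (v : Fin (k + 1) → ℝ) (hv : v ∈ Box θ.γ k) :
    betaOfRecord₁₃ F N θ k v =
      (letI := θ.instVβ₁; letI := θ.instVβ₂; letI := θ.instιβ
       beta0OfMerged (betaMerged F (mergedTermFamilyMatT F N (TβOfRecord₁₃ F N) (chiβOfRecord₁₃ F N θ) θ.εbg) θ.ρ8 θ.bV) θ.v₀ k) := by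
  letI := θ.instVβ₁; letI := θ.instVβ₂; letI := θ.instιβ
  have hconst : ∀ w : Fin (k + 1) → ℝ, w ∈ Box θ.γ k →
      betaMerged F (mergedTermFamilyMatT F N (TβOfRecord₁₃ F N) (chiβOfRecord₁₃ F N θ) θ.εbg) θ.ρ8 θ.bV k w =
        betaMerged F (mergedTermFamilyMatT F N (TβOfRecord₁₃ F N) (chiβOfRecord₁₃ F N θ) θ.εbg) θ.ρ8 θ.bV k v := fun w hw => by
    have h' := h k w v hw hv
    rwa [betaOfRecord₁₃_of_mem_box θ hw, betaOfRecord₁₃_of_mem_box θ hv] at h'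
  rw [betaOfRecord₁₃_of_mem_box θ hv, beta0OfMerged_eq_of_const_on_box hγ hv₀ hconst]

/-- **★ AT THE RECORD, β¹-FORM OF THE MISSING LETTER**: if at some scale `k` (base history inside the box) and some `v ∈ ]0, θ.γ]^{k+1}` the record's β differs from its own
one-loop number `beta0OfMerged βm_rec θ.v₀ k` — the printed split's remainder `β¹ k v ≠ 0` — then `betaOfRecord₁₃` is NOT boxwise constant (and the K3⁷ v3 guard follows under the
pin, §3b ∕ p592505). [folklore] -/
theorem not_boxwiseConstant_betaOfRecord₁₃_of_ne_beta0 (hγ : 0 < θ.γ) {k : ℕ} (hv₀ : BaseInBox θ.γ θ.v₀ k) {v : Fin (k + 1) → ℝ} (hv : v ∈ Box θ.γ k)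
    (hne : betaOfRecord₁₃ F N θ k v ≠
      (letI := θ.instVβ₁; letI := θ.instVβ₂; letI := θ.instιβ
       beta0OfMerged (betaMerged F (mergedTermFamilyMatT F N (TβOfRecord₁₃ F N) (chiβOfRecord₁₃ F N θ) θ.εbg) θ.ρ8 θ.bV) θ.v₀ k)) :
    ¬ BoxwiseConstant θ.γ (betaOfRecord₁₃ F N θ) :=
  fun h => hne (betaOfRecord₁₃_eq_beta0_on_box_of_boxwiseConstant θ hγ hv₀ h v hv)

end SplitFormRecord

end YMDAG.N18.BetaBoxDegeneracy

end
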